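/- Copyright: the b2b-balaban cell (near-miss cell 7), T⁴-continuum fan-out, NE7b crux team (2), leaf lineage
t4-ne7b-formalise-leaf-05 on the owner's INTERFACE REQUEST NE7b IR-99-2.  Released under the licence of the
surrounding project. -/
import Summits.QuantumFields.BalabanUV.T4Continuum.Support.B16HistoryInputFamily

/-!
# INSTANTIATION FROM THE LEVEL SETS, MEMORY-GENERIC PROCESS — CAUSALITY (IR-99-2, (A3) module J2a): the level-`j`
state of print's process `RunInputM.StM`, its extracted bookkeeping `histM.comp j` ∕ `histM.constit j`, its renewal
flags `rnwM j` and the consumer's `levelFactor … j c` are FUNCTIONS OF THE INPUT's PREFIX — two inputs with the same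
flow and readiness memory that agree on the new regions `N m` for `m ≤ j` and on the new-field cubes `F m` for `m < j`
(`m ≤ j` for `rnwM j`) produce the same level-`j` objects (INTERFACE REQUEST NE7b IR-99-2 of the row-NE7b OWNER
`t4-ne7b-p1` gen 99, journal [NE7bP1-G99-IR991] ∕ `HOME/INBOX.md` [NE7bP1-G99-INBOX-3]; filed by the author lineage of
`HistoryGenealogyInstantiateM`, leaf lineage `t4-ne7b-formalise-leaf-05` — PRE-POSITIONING ONLY)

Summits-side support leaf of the T⁴-continuum cell (rung (B)+1 on a FINITE torus only; NOT infinite volume, NOT the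
mass gap, NOT the Clay statement; NOT a proof of the spine estimate NE7b, which is the cell's OWN estimate, NOT PRINTED
and NOT PROVED).  [folklore] finite combinatorics: congruence lemmas for the `def`-ined objects of
`HistoryGenealogyInstantiateM` (`RunInputM.RdyM`, `AliveM`, `RnwM`, `vertM`, `blocksM`, `loneOldM`, `newLineM`, `formM`,
`StM`, `PrevM`, `enumBM`, `histM`, `rnwM` — REUSED, not re-declared), over row S15 brick 3 (`RunInput.P`, `Fld`,
`lab_newLineM`), brick 2 `HistoryTouchComponents` (`tcomps`, `subset_of_mem_tcomps`, `exists_chainTouch_enum_of_mem_tcomps`),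
`HistoryGenealogyInstantiateMWF` (`not_inl_mem_vertM_zero`), row S13∕S13-R (`ComponentHistory.parts`∕`news`∕`rfacs`) and
M2 brick B `B16HistoryInputFamily` (`HistFactors.levelFactor`); nothing printed is asserted, no `def … : Prop` fact of
Bałaban's, no cite-tagged hypothesis, no `NewOK` ∕ `Rm ≤ R` binder, zero `sorry`.  B16 = [Balaban1989LargeFieldII]
pp. 383–387 is a manuscript UNDER AUDIT; the process is OUR READING of its rules (locators in row S15's docstrings).

WHY (the owner's (A3) roadmap, J2).  In leaf-02's SHIFTED stencil for the tower instance (`histRead_tower_shifted`: a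
step's regions booked one level up, `N … (m+1) := reg m (h m)`, `N … 0 := ∅`) the step-`j` target
`∏_{c ∈ comp (j+1)} levelFactor (j+1) c` of the process read off a history `h` must be a function of the PREFIX
`h|_{j+1}`, so that the (A1c) supplier can DEFINE the per-step weight `w K j g p` as that product and the stencil display
holds by `le_rfl`.  This file supplies exactly that causality, generically over `RunInputM`, independent of IR-97-2 ∕
IR-99-1.

WHAT IS PROVED (for `I I' : RunInputM d`; `hL : I.L = I'.L`, `hs : I.s = I'.s`, `hRm : I.Rm = I'.Rm`).  §1 data
congruences `P_congr`, `RdyM_congr`, `Fld_congr`, `AliveM_congr`, `RnwM_congr`.  §2 ONE LEVEL over an ARBITRARY previous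
family `prev` (so that level `0`, `prev = ∅`, never consults `F 0`, and level `j+1`, `prev = StM j`, is the same lemma):
`vertM_congr` (readiness∕field agreement asked ON `prev` only), `blocksM_congr`, `loneOldM_congr` (renewal agreement asked
on the old vertices of the block only), `newLineM_congr`, `enumBM_congr` (the `dite` + `Classical.choose` term is a
function of `(P ℓ, vertM ℓ prev, T)`: equal predicates, then `subst`), `formM_congr`, `formM_congr_of_prev`.  §3 THE
PROCESS: **`StM_congr`** (`N` to level `j`, `F` BELOW `j` — induction on `StM_eq_formM`), `PrevM_congr`,
**`histM_comp_congr`**, **`histM_constit_congr`** (the `constit` predicate sees `newLineM` only through `lab_newLineM`),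
`parts_histM_zero` (level-0 components have no old parts — WITHOUT `NewOK`), `news_histM_subset` (the new regions listed
in a component of level `j` are among `N j` — WITHOUT `NewOK`), **`rnwM_congr`** (`N`, `F` to level `j`).  §4 THE
CONSUMER FORM: **`levelFactor_histM_congr`** — `Φf.levelFactor I.histM I.rnwM K j c = Φf.levelFactor I'.histM I'.rnwM K j c`
under `N` to level `j`, `F` below `j` and class agreement ON `N j` (sharper than a global `I.cls = I'.cls`, which is the
corollary `levelFactor_histM_congr'`), and the product over the level's components `prod_levelFactor_histM_congr` (primed: the
owner's J2b display `hcaus` letter for letter — §5's third example).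

HONEST.  Kernel algebra about OUR process; proves nothing of Bałaban's; BY-NAME EFFECT ON THE WALL: NONE (it serves the
prefix-defined stencil of J2b; the per-step display `hw` = (A1c) is where print enters); NE7b NOT proved; spine 0∕9.
HONEST DEPENDENCY (cell): continuum YM on T⁴ ⇐ BetaPertH ∧ nine spine estimates (0/9 proved); BetaPertH ⇐ (D1) ∧ (D4) ∧
CAP+tail; G-an2-4 gates asym, D1 and NE2/3/4.  This file changes none of it. -/

open Finset
open Summit.QuantumFields.BalabanUV.T4Continuum.HistoryGenealogyExtraction
open Summit.QuantumFields.BalabanUV.T4Continuum.HistoryGenealogyRealise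
open Summit.QuantumFields.BalabanUV.T4Continuum.HistoryTouchComponents
open Summit.QuantumFields.BalabanUV.T4Continuum.B16HistoryIndexedRepr

namespace Summit.QuantumFields.BalabanUV.T4Continuum.HistoryGenealogyInstantiate

noncomputable section

open Classical

variable {d : ℕ}

/-! ## §0 Chosen witnesses over equal predicates (private helpers) -/

/-- `Classical.choose` of two existentials over EQUAL predicates is the same witness [folklore] -/
private theorem choose_congr_of_eq {α : Sort*} {p q : α → Prop} (hpq : p = q) (hp : ∃ x, p x) (hq : ∃ x, q x) :
    Classical.choose hp = Classical.choose hq := by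
  subst hpq; rfl

/-- a `dite` on an existential, applying a function to the chosen witness, is a function of the predicate and of that
function on the predicate's carrier [folklore] -/
private theorem dite_choose_congr {α : Sort*} {β : Sort*} {p q : α → Prop} {_ : Decidable (∃ x, p x)}
    {_ : Decidable (∃ x, q x)} (hpq : p = q) {f g : α → β} (hfg : ∀ x, p x → f x = g x) (b : β) :
    (if h : ∃ x, p x then f (Classical.choose h) else b) = if h : ∃ x, q x then g (Classical.choose h) else b := by
  subst hpq
  by_cases h : ∃ x, p x
  · rw [dif_pos h, dif_pos h]; exact hfg _ (Classical.choose_spec h)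
  · rw [dif_neg h, dif_neg h]

namespace RunInputM

variable {I I' : RunInputM d}

/-! ## §1 Data congruences: images, readiness, new field, alive, renewed -/

/-- the IMAGES of the vertices depend on the flow `L`, `s` only [folklore] -/
theorem P_congr (hL : I.L = I'.L) (hs : I.s = I'.s) (ℓ : ℕ) : I.P ℓ = I'.P ℓ := by
  unfold RunInput.P; rw [hL, hs]

/-- READINESS depends on `L`, `s` and the memory `Rm` only [folklore] -/
theorem RdyM_congr (hL : I.L = I'.L) (hs : I.s = I'.s) (hRm : I.Rm = I'.Rm) : I.RdyM = I'.RdyM := by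
  funext j τ; unfold RdyM; rw [hL, hs, hRm]

/-- the NEW-FIELD test at level `j` depends on `F j` only [folklore] -/
theorem Fld_congr {j : ℕ} (hF : I.F j = I'.F j) : I.Fld j = I'.Fld j := by
  funext τ; unfold RunInput.Fld; rw [hF]

/-- ALIVE at level `j` depends on the flow, the memory and `F j` [folklore] -/
theorem AliveM_congr (hL : I.L = I'.L) (hs : I.s = I'.s) (hRm : I.Rm = I'.Rm) {j : ℕ} (hF : I.F j = I'.F j) :
    I.AliveM j = I'.AliveM j := by
  funext τ; unfold AliveM; rw [RdyM_congr hL hs hRm, Fld_congr hF]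

/-- RENEWED at level `j` depends on the flow, the memory and `F j` [folklore] -/
theorem RnwM_congr (hL : I.L = I'.L) (hs : I.s = I'.s) (hRm : I.Rm = I'.Rm) {j : ℕ} (hF : I.F j = I'.F j) :
    I.RnwM j = I'.RnwM j := by
  funext τ; unfold RnwM; rw [RdyM_congr hL hs hRm, Fld_congr hF]

/-! ## §2 One level of the process over an arbitrary previous family -/

/-- the VERTICES at level `ℓ` over `prev` depend on `N ℓ` and on `AliveM (ℓ − 1)` ON `prev` [folklore] -/
theorem vertM_congr {ℓ : ℕ} {prev : Finset (Line d)} (hA : ∀ τ ∈ prev, (I.AliveM (ℓ - 1) τ ↔ I'.AliveM (ℓ - 1) τ))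
    (hN : I.N ℓ = I'.N ℓ) : I.vertM ℓ prev = I'.vertM ℓ prev := by
  unfold vertM; rw [Finset.filter_congr hA, hN]

/-- the BLOCKS depend on the images and the vertices [folklore] -/
theorem blocksM_congr {ℓ : ℕ} {prev prev' : Finset (Line d)} (hP : I.P ℓ = I'.P ℓ)
    (hV : I.vertM ℓ prev = I'.vertM ℓ prev') : I.blocksM ℓ prev = I'.blocksM ℓ prev' := by
  unfold blocksM; rw [hP, hV]

/-- `loneOldM ℓ T` depends on `RnwM (ℓ − 1)` ON THE OLD VERTICES OF `T` only (the `dite` + `Classical.choose` term is a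
function of the predicate) [folklore] -/
theorem loneOldM_congr {ℓ : ℕ} {T : Finset (Line d ⊕ Lab d)}
    (hR : ∀ τ, Sum.inl τ ∈ T → (I.RnwM (ℓ - 1) τ ↔ I'.RnwM (ℓ - 1) τ)) : I.loneOldM ℓ T = I'.loneOldM ℓ T := by
  have hpq : (fun τ => T = {Sum.inl τ} ∧ ¬ I.RnwM (ℓ - 1) τ) = fun τ => T = {Sum.inl τ} ∧ ¬ I'.RnwM (ℓ - 1) τ := by
    funext τ
    have hmem : T = {Sum.inl τ} → Sum.inl τ ∈ T := fun h => by rw [h]; exact Finset.mem_singleton_self _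
    refine propext ⟨fun h => ⟨h.1, ?_⟩, fun h => ⟨h.1, ?_⟩⟩
    · rw [← hR τ (hmem h.1)]; exact h.2
    · rw [hR τ (hmem h.1)]; exact h.2
  unfold loneOldM
  exact dite_choose_congr hpq (f := some) (g := some) (fun _ _ => rfl) none

/-- the NEW LINE of a block depends on the images and on `loneOldM` [folklore] -/
theorem newLineM_congr {ℓ : ℕ} {T : Finset (Line d ⊕ Lab d)} (hP : I.P ℓ = I'.P ℓ)
    (hl : I.loneOldM ℓ T = I'.loneOldM ℓ T) : I.newLineM ℓ T = I'.newLineM ℓ T := by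
  unfold newLineM; rw [hl, hP]

/-- the CHOSEN ENUMERATION of a block is a function of `(P ℓ, vertM ℓ prev, T)` (`Classical.choose` over equal
predicates) [folklore] -/
theorem enumBM_congr {ℓ : ℕ} {prev prev' : Finset (Line d)} (hP : I.P ℓ = I'.P ℓ)
    (hV : I.vertM ℓ prev = I'.vertM ℓ prev') (T : Finset (Line d ⊕ Lab d)) :
    I.enumBM ℓ prev T = I'.enumBM ℓ prev' T := by
  unfold enumBM
  by_cases hT : T ∈ I.blocksM ℓ prev
  · have hT' : T ∈ I'.blocksM ℓ prev' := blocksM_congr hP hV ▸ hT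
    rw [dif_pos hT, dif_pos hT']
    exact choose_congr_of_eq (by rw [hP]) _ _
  · have hT' : T ∉ I'.blocksM ℓ prev' := blocksM_congr hP hV ▸ hT
    rw [dif_neg hT, dif_neg hT']

/-- the lines FORMED at level `ℓ` depend on the images, the vertices and `newLineM ℓ` ON THE BLOCKS [folklore] -/
theorem formM_congr {ℓ : ℕ} {prev : Finset (Line d)} (hP : I.P ℓ = I'.P ℓ) (hV : I.vertM ℓ prev = I'.vertM ℓ prev)
    (hnl : ∀ T ∈ I'.blocksM ℓ prev, I.newLineM ℓ T = I'.newLineM ℓ T) : I.formM ℓ prev = I'.formM ℓ prev := by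
  unfold formM
  rw [blocksM_congr hP hV]
  exact Finset.image_congr fun T hT => hnl T hT

/-- **ONE LEVEL OF THE PROCESS IS A FUNCTION OF `P ℓ`, `N ℓ` AND OF `AliveM (ℓ − 1)`, `RnwM (ℓ − 1)` ON THE PREVIOUS
LINES** (an old vertex of a block is a previous line). [folklore] -/
theorem formM_congr_of_prev {ℓ : ℕ} {prev : Finset (Line d)} (hP : I.P ℓ = I'.P ℓ) (hN : I.N ℓ = I'.N ℓ)
    (hA : ∀ τ ∈ prev, (I.AliveM (ℓ - 1) τ ↔ I'.AliveM (ℓ - 1) τ))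
    (hR : ∀ τ ∈ prev, (I.RnwM (ℓ - 1) τ ↔ I'.RnwM (ℓ - 1) τ)) : I.formM ℓ prev = I'.formM ℓ prev := by
  have hV := vertM_congr hA hN
  exact formM_congr hP hV fun T hT =>
    newLineM_congr hP (loneOldM_congr fun τ hτ => hR τ ((I'.inl_mem_vertM).1 (subset_of_mem_tcomps hT hτ)).1)

/-! ## §3 The process, its bookkeeping and its renewal flags -/

/-- **CAUSALITY OF THE PROCESS**: the live lines at level `j` depend on the flow, the memory, the new regions `N m`
for `m ≤ j` and the new-field cubes `F m` for `m < j`. [folklore] -/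
theorem StM_congr (hL : I.L = I'.L) (hs : I.s = I'.s) (hRm : I.Rm = I'.Rm) :
    ∀ j : ℕ, (∀ m ≤ j, I.N m = I'.N m) → (∀ m < j, I.F m = I'.F m) → I.StM j = I'.StM j
  | 0, hN, _ => by
      show I.formM 0 ∅ = I'.formM 0 ∅
      exact formM_congr_of_prev (P_congr hL hs 0) (hN 0 le_rfl) (by simp) (by simp)
  | j + 1, hN, hF => by
      show I.formM (j + 1) (I.StM j) = I'.formM (j + 1) (I'.StM j)
      rw [StM_congr hL hs hRm j (fun m hm => hN m (Nat.le_succ_of_le hm)) fun m hm => hF m (Nat.lt_succ_of_lt hm)]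
      have hA := AliveM_congr hL hs hRm (hF j (Nat.lt_succ_self j))
      have hR := RnwM_congr hL hs hRm (hF j (Nat.lt_succ_self j))
      exact formM_congr_of_prev (P_congr hL hs (j + 1)) (hN (j + 1) le_rfl)
        (fun τ _ => by rw [Nat.add_sub_cancel, hA]) fun τ _ => by rw [Nat.add_sub_cancel, hR]

/-- the previous level's lines depend on `N m` for `m < j` and `F m` for `m < j − 1` [folklore] -/
theorem PrevM_congr (hL : I.L = I'.L) (hs : I.s = I'.s) (hRm : I.Rm = I'.Rm) :
    ∀ j : ℕ, (∀ m < j, I.N m = I'.N m) → (∀ m < j - 1, I.F m = I'.F m) → I.PrevM j = I'.PrevM j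
  | 0, _, _ => rfl
  | j + 1, hN, hF =>
      StM_congr hL hs hRm j (fun m hm => hN m (Nat.lt_succ_of_le hm)) fun m hm => hF m (by omega)

/-- the vertices of level `j` over the previous lines depend on `N m` for `m ≤ j` and `F m` for `m < j` [folklore] -/
theorem vertM_PrevM_congr (hL : I.L = I'.L) (hs : I.s = I'.s) (hRm : I.Rm = I'.Rm) {j : ℕ}
    (hN : ∀ m ≤ j, I.N m = I'.N m) (hF : ∀ m < j, I.F m = I'.F m) :
    I.vertM j (I.PrevM j) = I'.vertM j (I'.PrevM j) := by
  rw [PrevM_congr hL hs hRm j (fun m hm => hN m hm.le) fun m hm => hF m (by omega)]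
  refine vertM_congr (fun τ hτ => ?_) (hN j le_rfl)
  cases j with
  | zero => simp [PrevM] at hτ
  | succ j => rw [Nat.add_sub_cancel, AliveM_congr hL hs hRm (hF j (Nat.lt_succ_self j))]

/-- **THE COMPONENTS OF LEVEL `j`** depend on `N m` for `m ≤ j` and `F m` for `m < j` [folklore] -/
theorem histM_comp_congr (hL : I.L = I'.L) (hs : I.s = I'.s) (hRm : I.Rm = I'.Rm) {j : ℕ}
    (hN : ∀ m ≤ j, I.N m = I'.N m) (hF : ∀ m < j, I.F m = I'.F m) : I.histM.comp j = I'.histM.comp j := by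
  show (I.StM j).image lab = (I'.StM j).image lab
  rw [StM_congr hL hs hRm j hN hF]

/-- **THE CONSTITUENT LISTS OF LEVEL `j`** depend on `N m` for `m ≤ j` and `F m` for `m < j` (the defining predicate
sees `newLineM` only through `lab_newLineM`; the enumeration by `enumBM_congr`) [folklore] -/
theorem histM_constit_congr (hL : I.L = I'.L) (hs : I.s = I'.s) (hRm : I.Rm = I'.Rm) {j : ℕ}
    (hN : ∀ m ≤ j, I.N m = I'.N m) (hF : ∀ m < j, I.F m = I'.F m) : I.histM.constit j = I'.histM.constit j := by
  have hP := P_congr hL hs j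
  have hV := vertM_PrevM_congr hL hs hRm hN hF
  have hB := blocksM_congr hP hV
  funext c
  show (if h : ∃ T ∈ I.blocksM j (I.PrevM j), lab (I.newLineM j T) = c then
      (I.enumBM j (I.PrevM j) (Classical.choose h)).map toLab else []) =
    (if h : ∃ T ∈ I'.blocksM j (I'.PrevM j), lab (I'.newLineM j T) = c then
      (I'.enumBM j (I'.PrevM j) (Classical.choose h)).map toLab else [])
  have hpq : (fun T => T ∈ I.blocksM j (I.PrevM j) ∧ lab (I.newLineM j T) = c) =
      fun T => T ∈ I'.blocksM j (I'.PrevM j) ∧ lab (I'.newLineM j T) = c := by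
    funext T; rw [lab_newLineM, lab_newLineM, hB, hP]
  exact dite_choose_congr hpq (f := fun T => (I.enumBM j (I.PrevM j) T).map toLab)
    (g := fun T => (I'.enumBM j (I'.PrevM j) T).map toLab) (fun T _ => by rw [enumBM_congr hP hV T]) []

/-- **LEVEL-`0` COMPONENTS HAVE NO OLD PARTS** — for ANY input (no `NewOK`): a level-`0` block has no old vertex.
[folklore] -/
theorem parts_histM_zero (I : RunInputM d) (c : Lab d) : I.histM.parts 0 c = [] := by
  rw [ComponentHistory.parts]
  by_cases h : ∃ T ∈ I.blocksM 0 (I.PrevM 0), lab (I.newLineM 0 T) = c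
  · have hc : I.histM.constit 0 c = (I.enumBM 0 (I.PrevM 0) (Classical.choose h)).map toLab := by
      show (if h : ∃ T ∈ I.blocksM 0 (I.PrevM 0), lab (I.newLineM 0 T) = c then
        (I.enumBM 0 (I.PrevM 0) (Classical.choose h)).map toLab else []) = _
      rw [dif_pos h]
    obtain ⟨hT, -⟩ := Classical.choose_spec h
    rw [hc, toLab, RunInput.lefts_map_sumMap, List.map_eq_nil_iff, List.eq_nil_iff_forall_not_mem]
    intro τ hτ
    exact I.not_inl_mem_vertM_zero τ
      (subset_of_mem_tcomps hT (((I.enumBM_spec hT).2.1 _).1 ((mem_lefts_iff τ _).1 hτ)))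
  · rw [I.constitM_eq_nil h]; rfl

/-- **THE NEW REGIONS LISTED IN A COMPONENT OF LEVEL `j` ARE AMONG `N j`** — for ANY input (no `NewOK`): the new
vertices of a block are new regions of the level. [folklore] -/
theorem news_histM_subset (I : RunInputM d) {j : ℕ} {c n : Lab d} (hn : n ∈ I.histM.news j c) : n ∈ I.N j := by
  rw [ComponentHistory.news] at hn
  by_cases h : ∃ T ∈ I.blocksM j (I.PrevM j), lab (I.newLineM j T) = c
  · have hc : I.histM.constit j c = (I.enumBM j (I.PrevM j) (Classical.choose h)).map toLab := by
      show (if h : ∃ T ∈ I.blocksM j (I.PrevM j), lab (I.newLineM j T) = c then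
        (I.enumBM j (I.PrevM j) (Classical.choose h)).map toLab else []) = _
      rw [dif_pos h]
    obtain ⟨hT, -⟩ := Classical.choose_spec h
    rw [hc, toLab, RunInput.rights_map_sumMap, List.map_id, mem_rights_iff] at hn
    exact (I.inr_mem_vertM).1 (subset_of_mem_tcomps hT (((I.enumBM_spec hT).2.1 _).1 hn))
  · rw [I.constitM_eq_nil h] at hn
    simp [rights] at hn

/-- **THE RENEWAL FLAGS OF LEVEL `j`** depend on `N m` and `F m` for `m ≤ j` [folklore] -/
theorem rnwM_congr (hL : I.L = I'.L) (hs : I.s = I'.s) (hRm : I.Rm = I'.Rm) {j : ℕ}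
    (hN : ∀ m ≤ j, I.N m = I'.N m) (hF : ∀ m ≤ j, I.F m = I'.F m) : I.rnwM j = I'.rnwM j := by
  funext p
  unfold rnwM
  rw [StM_congr hL hs hRm j hN fun m hm => hF m hm.le, RnwM_congr hL hs hRm (hF j le_rfl)]

/-! ## §4 The consumer form: the level factor of a component -/

/-- **CAUSALITY OF THE LEVEL FACTOR**: for two inputs with the same flow and memory agreeing on `N m` (`m ≤ j`), on
`F m` (`m < j`) and on the classes of the new regions of level `j`, the level-`j` factor of every label is the same for
both processes (`constit` ⇒ `parts`∕`news`∕`rfacs`; `rnwM (j − 1)`; level `0` has no parts). [folklore] -/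
theorem levelFactor_histM_congr {DomK : ℕ → Type*} {I₀ : (K : ℕ) → HIndex (DomK K)} (Φf : HistFactors I₀ d)
    (hL : I.L = I'.L) (hs : I.s = I'.s) (hRm : I.Rm = I'.Rm) {j : ℕ} (hN : ∀ m ≤ j, I.N m = I'.N m)
    (hF : ∀ m < j, I.F m = I'.F m) (hcls : ∀ n ∈ I.N j, I.cls n = I'.cls n) (K : ℕ) (c : Lab d) :
    Φf.levelFactor I.histM I.rnwM K j c = Φf.levelFactor I'.histM I'.rnwM K j c := by
  have hc : I.histM.constit j c = I'.histM.constit j c := congrFun (histM_constit_congr hL hs hRm hN hF) c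
  have hnews : I.histM.news j c = I'.histM.news j c := by
    rw [ComponentHistory.news, ComponentHistory.news, hc]
  have hparts : I.histM.parts j c = I'.histM.parts j c := by
    rw [ComponentHistory.parts, ComponentHistory.parts, hc]
  have hr : I.histM.rfacs I.rnwM (Φf.fR K) j c = I'.histM.rfacs I'.rnwM (Φf.fR K) j c := by
    cases j with
    | zero =>
        rw [ComponentHistory.rfacs, ComponentHistory.rfacs, parts_histM_zero, parts_histM_zero, List.map_nil,
          List.map_nil]
    | succ j =>
        rw [ComponentHistory.rfacs, ComponentHistory.rfacs, hparts, Nat.add_sub_cancel,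
          rnwM_congr hL hs hRm (j := j) (fun m hm => hN m (Nat.le_succ_of_le hm)) fun m hm =>
            hF m (Nat.lt_succ_of_le hm)]
  have hb : ((I.histM.news j c).map fun n => Φf.fB K j (I.histM.cls n) n).prod =
      ((I'.histM.news j c).map fun n => Φf.fB K j (I'.histM.cls n) n).prod := by
    rw [← hnews]
    exact congrArg List.prod (List.map_congr_left fun n hn => by
      rw [show I.histM.cls n = I'.histM.cls n from hcls n (I.news_histM_subset hn)])
  unfold HistFactors.levelFactor
  rw [hr, hb]

/-- the same under a GLOBAL class agreement `I.cls = I'.cls` (the owner's printed binder) [folklore] -/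
theorem levelFactor_histM_congr' {DomK : ℕ → Type*} {I₀ : (K : ℕ) → HIndex (DomK K)} (Φf : HistFactors I₀ d)
    (hL : I.L = I'.L) (hs : I.s = I'.s) (hRm : I.Rm = I'.Rm) {j : ℕ} (hN : ∀ m ≤ j, I.N m = I'.N m)
    (hF : ∀ m < j, I.F m = I'.F m) (hcls : I.cls = I'.cls) (K : ℕ) (c : Lab d) :
    Φf.levelFactor I.histM I.rnwM K j c = Φf.levelFactor I'.histM I'.rnwM K j c :=
  levelFactor_histM_congr Φf hL hs hRm hN hF (fun n _ => by rw [hcls]) K c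

/-- **THE STEP TARGET IS PREFIX-DEFINED**: the product of the level-`j` factors over the level-`j` components is the
same for both processes. [folklore] -/
theorem prod_levelFactor_histM_congr {DomK : ℕ → Type*} {I₀ : (K : ℕ) → HIndex (DomK K)} (Φf : HistFactors I₀ d)
    (hL : I.L = I'.L) (hs : I.s = I'.s) (hRm : I.Rm = I'.Rm) {j : ℕ} (hN : ∀ m ≤ j, I.N m = I'.N m)
    (hF : ∀ m < j, I.F m = I'.F m) (hcls : ∀ n ∈ I.N j, I.cls n = I'.cls n) (K : ℕ) :
    ∏ c ∈ I.histM.comp j, Φf.levelFactor I.histM I.rnwM K j c =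
      ∏ c ∈ I'.histM.comp j, Φf.levelFactor I'.histM I'.rnwM K j c :=
  Finset.prod_congr (histM_comp_congr hL hs hRm hN hF) fun c _ => levelFactor_histM_congr Φf hL hs hRm hN hF hcls K c

/-- the same under a GLOBAL class agreement, binders in the order of the owner's J2b display `hcaus`
(`L`, `s`, `Rm`, `cls`, `N` to level `j`, `F` below `j`): `hcaus := fun I I' K j hL hs hRm hcls hN hF =>
prod_levelFactor_histM_congr' Φf hL hs hRm hcls hN hF K`. [folklore] -/
theorem prod_levelFactor_histM_congr' {DomK : ℕ → Type*} {I₀ : (K : ℕ) → HIndex (DomK K)} (Φf : HistFactors I₀ d)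
    (hL : I.L = I'.L) (hs : I.s = I'.s) (hRm : I.Rm = I'.Rm) (hcls : I.cls = I'.cls) {j : ℕ}
    (hN : ∀ m ≤ j, I.N m = I'.N m) (hF : ∀ m < j, I.F m = I'.F m) (K : ℕ) :
    ∏ c ∈ I.histM.comp j, Φf.levelFactor I.histM I.rnwM K j c =
      ∏ c ∈ I'.histM.comp j, Φf.levelFactor I'.histM I'.rnwM K j c :=
  prod_levelFactor_histM_congr Φf hL hs hRm hN hF (fun n _ => by rw [hcls]) K

/-! ## §5 Sanity (kernel, zero weight): the hypothesis bundle is met by inputs that DIFFER above level `j` -/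

/-- K7-style witness: truncating an input's new regions above level `j` and its new-field cubes from level `j` on
changes the input (whenever something was there) but NOT the level-`j` state, by `StM_congr`. [folklore] -/
example (I : RunInputM d) (j : ℕ) :
    let I' : RunInputM d :=
      { I with N := fun m => if m ≤ j then I.N m else ∅, F := fun m => if m < j then I.F m else ∅ }
    I'.StM j = I.StM j := by
  intro I'
  exact StM_congr (I := I') (I' := I) rfl rfl rfl j (fun m hm => if_pos hm) fun m hm => if_pos hm

/-- the same witness for the consumer form: the level-`j` step target is unchanged by the truncation. [folklore] -/
example {DomK : ℕ → Type*} {I₀ : (K : ℕ) → HIndex (DomK K)} (Φf : HistFactors I₀ d) (I : RunInputM d) (j K : ℕ) :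
    let I' : RunInputM d :=
      { I with N := fun m => if m ≤ j then I.N m else ∅, F := fun m => if m < j then I.F m else ∅ }
    ∏ c ∈ I'.histM.comp j, Φf.levelFactor I'.histM I'.rnwM K j c =
      ∏ c ∈ I.histM.comp j, Φf.levelFactor I.histM I.rnwM K j c := by
  intro I'
  exact prod_levelFactor_histM_congr (I := I') (I' := I) Φf rfl rfl rfl (fun m hm => if_pos hm)
    (fun m hm => if_pos hm) (fun n _ => rfl) K

/-- the owner's J2b display `hcaus` (journal l.47115's roadmap; owner probe `ConcatStencil.J2b`), inhabited by
`prod_levelFactor_histM_congr'` letter for letter. [folklore] -/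
example {DomK : ℕ → Type*} {I₀ : (K : ℕ) → HIndex (DomK K)} (Φf : HistFactors I₀ d) :
    ∀ (I I' : RunInputM d) (K j : ℕ), I.L = I'.L → I.s = I'.s → I.Rm = I'.Rm → I.cls = I'.cls →
      (∀ m ≤ j, I.N m = I'.N m) → (∀ m < j, I.F m = I'.F m) →
      ∏ c ∈ I.histM.comp j, Φf.levelFactor I.histM I.rnwM K j c =
        ∏ c ∈ I'.histM.comp j, Φf.levelFactor I'.histM I'.rnwM K j c :=
  fun _ _ K _ hL hs hRm hcls hN hF => prod_levelFactor_histM_congr' Φf hL hs hRm hcls hN hF K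

end RunInputM

end

end Summit.QuantumFields.BalabanUV.T4Continuum.HistoryGenealogyInstantiate
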